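import Mathlib
import Summits.Ventures.HodgeRepro.Tier4.Target
import Summits.Ventures.HodgeRepro.Tier4.Common.TargetData

/-!
# Tier4/Line4/MixedTransfer — the transfer identity of LINE L4 (mixed-plane `(1,1)`-transfer)

Blind re-derivation cell `pub-hodge-repro`, Tier 4 «prove the step», seat t4-plan-4 (LINE L4, filed S12095; the
module the lead asked for in S12082 NOTE 1).  Everything here is fully PROVED (no placeholders): the `2×2`-determinant identity
`(p ∧ r) · conj (q ∧ t) = mixedCoeff p q r t` (`cross_identity`), its form as the coefficient of the wedge of two
MIXED `(1,1)`-forms `(du₁ ∧ conj du₃) ∧ (du₂ ∧ conj du₄)` (`jacDet_mul_conj_jacDet`), and the consequence for the frozen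
target's pairing: for every datum `d : TargetData F E`, every level, every domain `D` and every family `h` of Hecke
elements, `d.pairing D h = −mixedPairing d D h` (`pairing_eq_neg_mixedPairing`), where `mixedPairing d D h =
∫_D (coefficient of ξ₁₃(h) ∧ ξ₂₄(h) on dz₀ ∧ dz₁ ∧ dz̄₀ ∧ dz̄₁)` with `ξ₁₃(h) = du₁ ∧ conj du₃`, `ξ₂₄(h) = du₂ ∧ conj du₄`
(`u₁, u₂` the `s`-coordinates of the translated lifts of the corners `i₁, i₂`; `u₃, u₄` the `s̄`-coordinates of those of
`i₃, i₄`).  This is the whole transfer of LINE L4: (P) for the datum is the non-vanishing of an INTERSECTION NUMBER of two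
mixed `(1,1)`-classes on the surface `X_{Γ′}` — the spectral work then happens on the primitive `(1,1)`-part (the
skeleton `Tier4/Line4/Skeleton.lean`, lemmas L4.1–L4.3).  Sign convention: `dz_k ∧ dz̄_l ∧ dz_m ∧ dz̄_n =
−ε_{km} ε_{ln} · dz₀ ∧ dz₁ ∧ dz̄₀ ∧ dz̄₁` (`wedgeCoeff11`).  Imports only Mathlib and the landed Tier-4 modules
`Tier4.Target` (frozen) and `Tier4.Common.TargetData`.  HC_CM is NOT proved by anyone in this repository.
-/

noncomputable section

open Matrix MeasureTheory NumberField
open scoped ComplexConjugate ComplexOrder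

namespace Summit.Ventures.HodgeRepro.Tier4.Line4

open Summit.Ventures.HodgeRepro.Tier4

/-! ## 0. The transfer identity: `jac_s · conj jac_{s̄}` as the wedge of two mixed `(1,1)`-forms -/

/-- The coefficient of `(p ⊗ conj q) ∧ (r ⊗ conj t)` written out: with `ξ_{kl} = p_k conj(q_l)` and
`ξ′_{mn} = r_m conj(t_n)`, this is `Σ_{k≠m, l≠n} ε_{km} ε_{ln} ξ_{kl} ξ′_{mn}` (= `−` the coefficient of `ξ ∧ ξ′` on
`dz₀ ∧ dz₁ ∧ dz̄₀ ∧ dz̄₁`). -/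
def mixedCoeff (p q r t : Fin 2 → ℂ) : ℂ :=
  p 0 * conj (q 0) * (r 1 * conj (t 1)) - p 0 * conj (q 1) * (r 1 * conj (t 0))
    - p 1 * conj (q 0) * (r 0 * conj (t 1)) + p 1 * conj (q 1) * (r 0 * conj (t 0))

/-- **The cross identity** (`2×2` determinants): `(p ∧ r) · conj (q ∧ t) = mixedCoeff p q r t`. -/
theorem cross_identity (p q r t : Fin 2 → ℂ) :
    wedge p r * conj (wedge q t) = mixedCoeff p q r t := by
  simp only [wedge, mixedCoeff, map_sub, map_mul]
  ring

/-- The coefficient matrix of a `(1,1)`-form `ξ = Σ_{k,l} ξ_{kl} dz_k ∧ dz̄_l`. -/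
abbrev Form11 := Matrix (Fin 2) (Fin 2) ℂ

/-- The coefficient of `ξ ∧ ξ′` on `dz₀ ∧ dz₁ ∧ dz̄₀ ∧ dz̄₁` for two `(1,1)`-forms given by their coefficient matrices
(`dz_k ∧ dz̄_l ∧ dz_m ∧ dz̄_n = −ε_{km} ε_{ln} dz₀ ∧ dz₁ ∧ dz̄₀ ∧ dz̄₁`). -/
def wedgeCoeff11 (ξ ξ' : Form11) : ℂ :=
  -(ξ 0 0 * ξ' 1 1 - ξ 0 1 * ξ' 1 0 - ξ 1 0 * ξ' 0 1 + ξ 1 1 * ξ' 0 0)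

/-- The mixed `(1,1)`-form `p ∧ conj q` of two `(1,0)`-covectors: `ξ_{kl} = p_k conj(q_l)`. -/
def mixedForm (p q : Fin 2 → ℂ) : Form11 := Matrix.of fun k l => p k * conj (q l)

/-- The coefficient of `(p ∧ conj q) ∧ (r ∧ conj t)` is `−mixedCoeff p q r t`. -/
theorem wedgeCoeff11_mixedForm (p q r t : Fin 2 → ℂ) :
    wedgeCoeff11 (mixedForm p q) (mixedForm r t) = -mixedCoeff p q r t := by
  simp only [wedgeCoeff11, mixedForm, mixedCoeff, Matrix.of_apply]

/-- The gradient `(∂₀u, ∂₁u)` of a scalar function on `ℂ²` (the coefficients of `du` on `dz₀, dz₁`). -/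
def grad (u : (Fin 2 → ℂ) → ℂ) (z : Fin 2 → ℂ) : Fin 2 → ℂ := fun k => pd k u z

/-- Pointwise: `jac(u₁,u₂) · conj jac(u₃,u₄) = −(coefficient of (du₁ ∧ conj du₃) ∧ (du₂ ∧ conj du₄))`. -/
theorem jacDet_mul_conj_jacDet (u₁ u₂ u₃ u₄ : (Fin 2 → ℂ) → ℂ) (z : Fin 2 → ℂ) :
    jacDet u₁ u₂ z * conj (jacDet u₃ u₄ z) =
      -wedgeCoeff11 (mixedForm (grad u₁ z) (grad u₃ z)) (mixedForm (grad u₂ z) (grad u₄ z)) := by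
  rw [wedgeCoeff11_mixedForm, neg_neg]
  unfold jacDet grad
  exact cross_identity _ _ _ _

/-! ## 1. The mixed forms of the datum and the transferred pairing -/

variable {F E : Type} [Field F] [NumberField F] [IsGalois ℚ F] [IsCMField F]
  [Field E] [NumberField E] [IsGalois ℚ E] [IsCMField E] (d : TargetData F E)

/-- `u₁ = (T_{h_{i₁}} a_{i₁})_s`, the `s`-coordinate of the translated lift of the corner `i₁`. -/
def u₁ (h : Fin 4 → HeckeElement E) : (Fin 2 → ℂ) → ℂ :=
  comp (d.T d.i₁) d.s d.hs₁ (d.lift (h d.i₁) d.i₁)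

/-- `u₂ = (T_{h_{i₂}} a_{i₂})_s`. -/
def u₂ (h : Fin 4 → HeckeElement E) : (Fin 2 → ℂ) → ℂ :=
  comp (d.T d.i₂) d.s d.hs₂ (d.lift (h d.i₂) d.i₂)

/-- `u₃ = (T_{h_{i₃}} a_{i₃})_{s̄}`, the `s̄`-coordinate of the translated lift of the corner `i₃`. -/
def u₃ (h : Fin 4 → HeckeElement E) : (Fin 2 → ℂ) → ℂ :=
  comp (d.T d.i₃) (conjEmb d.s) d.hs₃ (d.lift (h d.i₃) d.i₃)

/-- `u₄ = (T_{h_{i₄}} a_{i₄})_{s̄}`. -/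
def u₄ (h : Fin 4 → HeckeElement E) : (Fin 2 → ℂ) → ℂ :=
  comp (d.T d.i₄) (conjEmb d.s) d.hs₄ (d.lift (h d.i₄) d.i₄)

/-- The first mixed `(1,1)`-form `ξ₁₃(h) = du₁ ∧ conj du₃` (coefficient matrix, as a function of `z`). -/
def ξ₁₃ (h : Fin 4 → HeckeElement E) : (Fin 2 → ℂ) → Form11 :=
  fun z => mixedForm (grad (u₁ d h) z) (grad (u₃ d h) z)

/-- The second mixed `(1,1)`-form `ξ₂₄(h) = du₂ ∧ conj du₄`. -/
def ξ₂₄ (h : Fin 4 → HeckeElement E) : (Fin 2 → ℂ) → Form11 :=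
  fun z => mixedForm (grad (u₂ d h) z) (grad (u₄ d h) z)

/-- The transferred pairing: `∫_D (coefficient of ξ₁₃ ∧ ξ₂₄)` — the intersection number `[ξ₁₃]·[ξ₂₄]` once `D` is a
fundamental domain and the forms are closed and `Γ′`-invariant. -/
def mixedPairing (D : Set (Fin 2 → ℂ)) (h : Fin 4 → HeckeElement E) : ℂ :=
  ∫ z in D, wedgeCoeff11 (ξ₁₃ d h z) (ξ₂₄ d h z)

/-- `jac_s = wedge (∂u₁, ∂u₂)`: the target's `jacS` is the Jacobian of the `s`-coordinates `u₁, u₂`. -/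
theorem jacS_eq (h : Fin 4 → HeckeElement E) : d.jacS h = jacDet (u₁ d h) (u₂ d h) := rfl

/-- `jac_s̄ = wedge (∂u₃, ∂u₄)`: the target's `jacSbar` is the Jacobian of the `s̄`-coordinates `u₃, u₄`. -/
theorem jacSbar_eq (h : Fin 4 → HeckeElement E) : d.jacSbar h = jacDet (u₃ d h) (u₄ d h) := rfl

/-- **The transfer**: the target's pairing is MINUS the transferred `(1,1)`-pairing, for every `D` and every `h`. -/
theorem pairing_eq_neg_mixedPairing (D : Set (Fin 2 → ℂ)) (h : Fin 4 → HeckeElement E) :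
    d.pairing D h = -mixedPairing d D h := by
  unfold TargetData.pairing mixedPairing
  rw [← integral_neg]
  refine congrArg (integral (volume.restrict D)) ?_
  funext z
  rw [jacS_eq, jacSbar_eq, jacDet_mul_conj_jacDet]
  rfl

end Summit.Ventures.HodgeRepro.Tier4.Line4

end

#print axioms Summit.Ventures.HodgeRepro.Tier4.Line4.cross_identity
#print axioms Summit.Ventures.HodgeRepro.Tier4.Line4.jacDet_mul_conj_jacDet
#print axioms Summit.Ventures.HodgeRepro.Tier4.Line4.pairing_eq_neg_mixedPairing
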